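import Summits.HubbardSuperconductivity.HubbardSuperconductivity.Theorems.AnisotropyChordCondensateSlabKappaPos
import Summits.HubbardSuperconductivity.HubbardSuperconductivity.Theorems.AnisotropyChordCondensateSlabCalculus
import Summits.HubbardSuperconductivity.HubbardSuperconductivity.Theorems.AnisotropyChordCondensateSlabDefs
import Summits.HubbardSuperconductivity.HubbardSuperconductivity.Theorems.AnisotropyChordThermalCondensateResponse

/-!
# Route `AnisotropyChord`, crux `ChordXY` (stmt-HubbardSuperconductivity-8146), line `condensate-slab`:
# registered stub `stub_slabConcave_smallBeta` — SMALL-`β` CONCAVITY of the slab condensate (proved)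

Notation: even `M ≥ 4`, `H_M(Δ) = xxzHamiltonian 1 (torusGraph 2 M) (-1) Δ = H₀ + Δ V` (pencil,
`xxzTorus_pencil`), `φ = P₀𝟙` (the polarised boundary vector = half-filled indicator), `A = S⁺_tot S⁻_tot`,
`a = (M²/2)(M²/2+1)` (`Aφ = aφ`), `v_β(Δ) = e^{-βH_M(Δ)} φ` (`slabVec`), and the slab condensate
`Λˢ_{β,M}(Δ) = Re(⟨v_β, A v_β⟩/⟨v_β, v_β⟩)` (`slabCondensate`).

Proof (Kato-free, division-free linearisation):
1. `v_β = φ + β·y_β`, `y_β(Δ) = −H_M(Δ) ψ(−βH_M(Δ)) φ` with the ENTIRE function `ψ(X) = Σ X^n/(n+1)!`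
   (`X ψ(X) = e^X − 1`, `mul_slabPsi_eq_exp_sub_one`); hence, `Aφ = aφ` and `A = Aᴴ` killing the cross
   terms (`form_expand_eigen`), the EXACT identity `Λˢ_{β,M}(Δ) = a − β²·G(β,Δ)`,
   `G = (a⟨y,y⟩ − ⟨y,Ay⟩)/⟨v,v⟩`.
2. `G` is `C^∞` on `ℝ × ℝ` (compositions of the matrix exponential / `ψ` with polynomial maps; the
   denominator `⟨v,v⟩ > 0` since `e^{-βH}` is invertible and `φ ≠ 0`), so `∂²_Δ G` is jointly continuous
   (`continuous_iteratedDeriv_two_curry`).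
3. At `β = 0`: `G(0,Δ) = (q(H₀φ) + c·Δ + κ·Δ²)/‖φ‖²`, `q(x) = a‖x‖² − Re⟨x,Ax⟩`, `κ = q(Vφ) > 0`
   (`slab_kappa_pos`), so `∂²_Δ G(0,Δ) = 2κ/‖φ‖² > 0`.
4. Tube lemma over the compact pencil `{0} × [−1,0]` ⇒ `∂²_Δ G(β,Δ) > 0` for `|β| < ε`, `Δ ∈ [−1,0]`
   ⇒ `G(β,·)` convex (second-derivative test) ⇒ `Λˢ_{β,M} = a − β²G(β,·)` CONCAVE on `[−1,0]` for
   `0 < β ≤ ε/2`.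

This is the graph-blind RUNG of the line (it carries no `d = 2` information); the research step
`stub_slabConcavity_propagates` (all `β`) is untouched.  Sources: T. Kato, *Perturbation Theory for
Linear Operators*, II §2 (finite-dimensional analytic perturbation — replaced here by an exact identity);
H. Tasaki (2020) §2.4–2.5.  Folklore; no definition is introduced; sorry-free.
HONEST: nothing here proves `ChordXY`; superconductivity in the Hubbard model is not advanced.
-/

set_option linter.dupNamespace false

noncomputable section

namespace Summit.HubbardSuperconductivity.HubbardSuperconductivity.Theorems.AnisotropyChord

open scoped Matrix.Norms.L2Operator ComplexOrder
open Matrix Filter Topology FormalMultilinearSeries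
open Literature.MathematicalPhysics.QuantumLattice Literature.Probability.LatticeModels

/-! ### Two elementary lemmas -/

/-- The second derivative of a real quadratic `x ↦ e₀ + e₁ x + e₂ x²` is the constant `2 e₂`. [folklore] -/
theorem iteratedDeriv_two_quadratic (e₀ e₁ e₂ : ℝ) :
    iteratedDeriv 2 (fun x : ℝ => e₀ + e₁ * x + e₂ * x ^ 2) = fun _ => 2 * e₂ := by
  have h1 : deriv (fun x : ℝ => e₀ + e₁ * x + e₂ * x ^ 2) = fun x => e₁ + 2 * e₂ * x := by
    funext x
    have h : HasDerivAt (fun x : ℝ => e₀ + e₁ * x + e₂ * x ^ 2)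
        (0 + e₁ * 1 + e₂ * ((2 : ℕ) * x ^ (2 - 1))) x :=
      ((hasDerivAt_const x e₀).add ((hasDerivAt_id x).const_mul e₁)).add
        ((hasDerivAt_pow 2 x).const_mul e₂)
    rw [h.deriv]
    simp
    ring
  have h2 : deriv (fun x : ℝ => e₁ + 2 * e₂ * x) = fun _ => 2 * e₂ := by
    funext x
    have h : HasDerivAt (fun x : ℝ => e₁ + 2 * e₂ * x) (0 + 2 * e₂ * 1) x :=
      (hasDerivAt_const x e₁).add ((hasDerivAt_id x).const_mul (2 * e₂))
    rw [h.deriv]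
    ring
  rw [iteratedDeriv_succ, iteratedDeriv_one, h1, h2]

/-- **Expansion of the quadratic forms along `v = φ + β y`** when `φ` is an `a`-eigenvector of the
Hermitian matrix `A`: `⟨v, Av⟩ = a⟨v, v⟩ − β²·(a⟨y, y⟩ − ⟨y, Ay⟩)` (the cross terms cancel). [folklore] -/
theorem form_expand_eigen {ι : Type*} [Fintype ι] [DecidableEq ι] (A : Matrix ι ι ℂ)
    (hA : A.IsHermitian) (φ y : ι → ℂ) (a β : ℝ) (hAφ : A *ᵥ φ = ((a : ℝ) : ℂ) • φ) :
    star (φ + ((β : ℝ) : ℂ) • y) ⬝ᵥ (A *ᵥ (φ + ((β : ℝ) : ℂ) • y)) =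
      ((a : ℝ) : ℂ) * (star (φ + ((β : ℝ) : ℂ) • y) ⬝ᵥ (φ + ((β : ℝ) : ℂ) • y)) -
        ((β : ℝ) : ℂ) ^ 2 * (((a : ℝ) : ℂ) * (star y ⬝ᵥ y) - star y ⬝ᵥ (A *ᵥ y)) := by
  have hφAy : star φ ⬝ᵥ (A *ᵥ y) = ((a : ℝ) : ℂ) * (star φ ⬝ᵥ y) := by
    have h1 : star φ ᵥ* A = star (A *ᵥ φ) := by
      conv_lhs => rw [← hA.eq]
      rw [← star_mulVec]
    rw [dotProduct_mulVec, h1, hAφ, star_smul, Complex.star_def, Complex.conj_ofReal, smul_dotProduct,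
      smul_eq_mul]
  have hyAφ : star y ⬝ᵥ (A *ᵥ φ) = ((a : ℝ) : ℂ) * (star y ⬝ᵥ φ) := by
    rw [hAφ, dotProduct_smul, smul_eq_mul]
  have hφAφ : star φ ⬝ᵥ (A *ᵥ φ) = ((a : ℝ) : ℂ) * (star φ ⬝ᵥ φ) := by
    rw [hAφ, dotProduct_smul, smul_eq_mul]
  have hs : star (((β : ℝ) : ℂ) • y) = ((β : ℝ) : ℂ) • star y := by
    rw [star_smul, Complex.star_def, Complex.conj_ofReal]
  simp only [mulVec_add, mulVec_smul, star_add, hs, add_dotProduct, dotProduct_add, smul_dotProduct,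
    dotProduct_smul, smul_eq_mul, hφAy, hyAφ, hφAφ]
  ring

/-! ### The stub -/

/-- **SMALL-`β` CONCAVITY OF THE SLAB CONDENSATE** (def-free form of the registered stub
`stub_slabConcave_smallBeta`): for every even `M ≥ 4` there is `β₀ > 0` such that
`Δ ↦ Λˢ_{β,M}(Δ)` is concave on `[-1, 0]` for all `β ∈ (0, β₀]`. Kato II §2 (here via the exact
identity `Λˢ = a − β² G`). [folklore] -/
theorem slabCondensate_concaveOn_smallBeta (M : ℕ) [NeZero M] (hM : Even M) (h4 : 4 ≤ M) :
    ∃ β₀ : ℝ, 0 < β₀ ∧ ∀ β ∈ Set.Ioc (0:ℝ) β₀,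
      ConcaveOn ℝ (Set.Icc (-1:ℝ) 0) (fun Δ : ℝ => CondensateSlab.slabCondensate M β Δ) := by
  -- the objects
  set H0 : Matrix (TorusSite 2 M → Fin 2) (TorusSite 2 M → Fin 2) ℂ :=
    xxzHamiltonian 1 (torusGraph 2 M) (-1) 0 with hH0
  set Vm : Matrix (TorusSite 2 M → Fin 2) (TorusSite 2 M → Fin 2) ℂ :=
    xxzHamiltonian 1 (torusGraph 2 M) (-1) 1 - xxzHamiltonian 1 (torusGraph 2 M) (-1) 0 with hVm
  set φ : (TorusSite 2 M → Fin 2) → ℂ := sectorProj M *ᵥ fun _ => (1 : ℂ) with hφ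
  set A : Matrix (TorusSite 2 M → Fin 2) (TorusSite 2 M → Fin 2) ℂ := condensateOp M with hA
  set a : ℝ := ((M ^ 2 / 2 : ℕ) : ℝ) * (((M ^ 2 / 2 : ℕ) : ℝ) + 1) with ha
  set ψS : Matrix (TorusSite 2 M → Fin 2) (TorusSite 2 M → Fin 2) ℂ →
      Matrix (TorusSite 2 M → Fin 2) (TorusSite 2 M → Fin 2) ℂ :=
    ofScalarsSum (E := Matrix (TorusSite 2 M → Fin 2) (TorusSite 2 M → Fin 2) ℂ)
      (fun n => ((Nat.factorial (n + 1) : ℂ))⁻¹) with hψS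
  set Hm : ℝ → Matrix (TorusSite 2 M → Fin 2) (TorusSite 2 M → Fin 2) ℂ :=
    fun Δ => H0 + ((Δ : ℝ) : ℂ) • Vm with hHm
  set Xf : ℝ × ℝ → Matrix (TorusSite 2 M → Fin 2) (TorusSite 2 M → Fin 2) ℂ :=
    fun p => (-((p.1 : ℝ) : ℂ)) • Hm p.2 with hXf
  set wf : ℝ × ℝ → (TorusSite 2 M → Fin 2) → ℂ := fun p => ψS (Xf p) *ᵥ φ with hwf
  set vf : ℝ × ℝ → (TorusSite 2 M → Fin 2) → ℂ := fun p => NormedSpace.exp (Xf p) *ᵥ φ with hvf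
  set yf : ℝ × ℝ → (TorusSite 2 M → Fin 2) → ℂ := fun p => -(Hm p.2 *ᵥ wf p) with hyf
  set Nf : ℝ × ℝ → ℝ :=
    fun p => a * (star (yf p) ⬝ᵥ yf p).re - (star (yf p) ⬝ᵥ (A *ᵥ yf p)).re with hNf
  set Df : ℝ × ℝ → ℝ := fun p => (star (vf p) ⬝ᵥ vf p).re with hDf
  set Gf : ℝ × ℝ → ℝ := fun p => Nf p / Df p with hGf
  -- algebraic inputs
  have hpencil : ∀ Δ : ℝ, xxzHamiltonian 1 (torusGraph 2 M) (-1) Δ = Hm Δ := by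
    intro Δ
    rw [hHm, hH0, hVm, xxzTorus_pencil M Δ 0, sub_zero]
  have hAφ : A *ᵥ φ = ((a : ℝ) : ℂ) • φ := condensateOp_mulVec_sectorProj_ones M hM
  have hApsd : A.PosSemidef := condensateOp_posSemidef M
  have hAherm : A.IsHermitian := hApsd.isHermitian
  have hφpos : 0 < (star φ ⬝ᵥ φ).re := star_dotProduct_sectorProj_ones_pos M hM
  have hφne : φ ≠ 0 := sectorProj_mulVec_ones_ne_zero M hM
  -- (1) the linearisation `v = φ + β y`
  have hvy : ∀ β Δ : ℝ, vf (β, Δ) = φ + ((β : ℝ) : ℂ) • yf (β, Δ) := by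
    intro β Δ
    have h1 : NormedSpace.exp (Xf (β, Δ)) = (Xf (β, Δ) * ψS (Xf (β, Δ))) + 1 := by
      rw [hψS, mul_slabPsi_eq_exp_sub_one, sub_add_cancel]
    simp only [hvf, hyf, hwf]
    rw [h1, add_mulVec, one_mulVec, ← mulVec_mulVec, add_comm]
    congr 1
    simp only [hXf]
    rw [smul_mulVec, neg_smul, smul_neg]
  -- positivity of the denominator
  have hDpos : ∀ p : ℝ × ℝ, 0 < Df p := by
    intro p
    have hv : vf p ≠ 0 := by
      intro h0
      apply hφne
      have hinj := Matrix.mulVec_injective_iff_isUnit.mpr (Matrix.isUnit_exp (Xf p))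
      have h1 : NormedSpace.exp (Xf p) *ᵥ φ = NormedSpace.exp (Xf p) *ᵥ 0 := by
        rw [mulVec_zero]; exact h0
      exact hinj h1
    exact (Complex.pos_iff.mp (dotProduct_star_self_pos_iff.mpr hv)).1
  -- the two quadratic forms are real
  have hN_real : ∀ p : ℝ × ℝ, ((a : ℝ) : ℂ) * (star (yf p) ⬝ᵥ yf p) - star (yf p) ⬝ᵥ (A *ᵥ yf p) =
      ((Nf p : ℝ) : ℂ) := by
    intro p
    have h1 := (Complex.nonneg_iff.mp (dotProduct_star_self_nonneg (yf p))).2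
    have h2 := (Complex.nonneg_iff.mp (hApsd.dotProduct_mulVec_nonneg (yf p))).2
    refine Complex.ext ?_ ?_
    · simp [hNf]
    · simp [← h1, ← h2]
  have hD_real : ∀ p : ℝ × ℝ, star (vf p) ⬝ᵥ vf p = ((Df p : ℝ) : ℂ) := by
    intro p
    have h1 := (Complex.nonneg_iff.mp (dotProduct_star_self_nonneg (vf p))).2
    exact Complex.ext (by simp [hDf]) (by simp [← h1])
  -- (1') the exact identity `Λˢ = a − β² G`
  have hident : ∀ β Δ : ℝ, CondensateSlab.slabCondensate M β Δ = a - β ^ 2 * Gf (β, Δ) := by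
    intro β Δ
    rw [CondensateSlab.slabCondensate_eq, CondensateSlab.slabVec_eq, hpencil Δ]
    have hv : gibbsWeight β (Hm Δ) *ᵥ (sectorProj M *ᵥ fun _ => (1 : ℂ)) = vf (β, Δ) := by
      simp only [hvf, hXf, Matrix.gibbsWeight, hφ]
    rw [hv, ← hA, hvy β Δ, form_expand_eigen A hAherm φ (yf (β, Δ)) a β hAφ, ← hvy β Δ,
      hN_real, hD_real]
    have hD0 : ((Df (β, Δ) : ℝ) : ℂ) ≠ 0 := Complex.ofReal_ne_zero.mpr (hDpos (β, Δ)).ne'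
    rw [sub_div, mul_div_cancel_right₀ _ hD0, mul_div_assoc, ← Complex.ofReal_div, ← Complex.ofReal_pow,
      ← Complex.ofReal_mul, ← Complex.ofReal_sub, Complex.ofReal_re]
  -- (2) smoothness
  have hofReal1 : ContDiff ℝ ⊤ (fun p : ℝ × ℝ => ((p.1 : ℝ) : ℂ)) :=
    Complex.ofRealCLM.contDiff.comp contDiff_fst
  have hofReal2 : ContDiff ℝ ⊤ (fun p : ℝ × ℝ => ((p.2 : ℝ) : ℂ)) :=
    Complex.ofRealCLM.contDiff.comp contDiff_snd
  have hHm_cd : ContDiff ℝ ⊤ (fun p : ℝ × ℝ => Hm p.2) := by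
    simp only [hHm]
    exact contDiff_const.add (hofReal2.smul contDiff_const)
  have hX_cd : ContDiff ℝ ⊤ Xf := by
    simp only [hXf]
    exact hofReal1.neg.smul hHm_cd
  have hw_cd : ContDiff ℝ ⊤ wf := by
    simp only [hwf, hψS]
    exact (contDiff_mulVec_const φ).comp (slabPsi_contDiff.comp hX_cd)
  have hv_cd : ContDiff ℝ ⊤ vf := by
    simp only [hvf]
    exact (contDiff_mulVec_const φ).comp (exp_contDiff_real_matrix.comp hX_cd)
  have hy_cd : ContDiff ℝ ⊤ yf := by
    have h : yf = fun p => -(H0 *ᵥ wf p + ((p.2 : ℝ) : ℂ) • (Vm *ᵥ wf p)) := by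
      funext p
      simp only [hyf, hHm]
      rw [add_mulVec, smul_mulVec]
    rw [h]
    exact ((contDiff_const_mulVec H0 hw_cd).add (hofReal2.smul (contDiff_const_mulVec Vm hw_cd))).neg
  have hN_cd : ContDiff ℝ ⊤ Nf := by
    simp only [hNf]
    exact (contDiff_const.mul (Complex.reCLM.contDiff.comp (contDiff_star_dotProduct hy_cd hy_cd))).sub
      (Complex.reCLM.contDiff.comp (contDiff_star_dotProduct hy_cd (contDiff_const_mulVec A hy_cd)))
  have hD_cd : ContDiff ℝ ⊤ Df := by
    simp only [hDf]
    exact Complex.reCLM.contDiff.comp (contDiff_star_dotProduct hv_cd hv_cd)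
  have hG_cd : ContDiff ℝ ⊤ Gf := by
    simp only [hGf]
    exact hN_cd.div hD_cd fun p => (hDpos p).ne'
  have hG2 : ContDiff ℝ 2 Gf := hG_cd.of_le le_top
  -- (3) the value at `β = 0`
  set w₀ : (TorusSite 2 M → Fin 2) → ℂ := H0 *ᵥ φ with hw₀
  set w₁ : (TorusSite 2 M → Fin 2) → ℂ := Vm *ᵥ φ with hw₁
  set κ : ℝ := a * (star w₁ ⬝ᵥ w₁).re - (star w₁ ⬝ᵥ (A *ᵥ w₁)).re with hκ
  have hκpos : 0 < κ := by
    have h := slab_kappa_pos M hM h4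
    simp only [hκ, hw₁, hVm, hA, hφ, ha]
    linarith
  set d₀ : ℝ := (star φ ⬝ᵥ φ).re with hd₀
  have hX0 : ∀ Δ : ℝ, Xf (0, Δ) = 0 := by
    intro Δ
    simp only [hXf, Complex.ofReal_zero, neg_zero, zero_smul]
  have hw0 : ∀ Δ : ℝ, wf (0, Δ) = φ := by
    intro Δ
    simp only [hwf, hX0 Δ, hψS, slabPsi_zero, one_mulVec]
  have hv0 : ∀ Δ : ℝ, vf (0, Δ) = φ := by
    intro Δ
    simp only [hvf, hX0 Δ, NormedSpace.exp_zero, one_mulVec]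
  have hy0 : ∀ Δ : ℝ, yf (0, Δ) = -(w₀ + ((Δ : ℝ) : ℂ) • w₁) := by
    intro Δ
    simp only [hyf, hw0 Δ, hHm, hw₀, hw₁, add_mulVec, smul_mulVec]
  set c₁ : ℝ := a * (star w₀ ⬝ᵥ w₁ + star w₁ ⬝ᵥ w₀).re -
    (star w₀ ⬝ᵥ (A *ᵥ w₁) + star w₁ ⬝ᵥ (A *ᵥ w₀)).re with hc₁
  set q₀ : ℝ := a * (star w₀ ⬝ᵥ w₀).re - (star w₀ ⬝ᵥ (A *ᵥ w₀)).re with hq₀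
  have hG0 : ∀ Δ : ℝ, Gf (0, Δ) = q₀ / d₀ + (c₁ / d₀) * Δ + (κ / d₀) * Δ ^ 2 := by
    intro Δ
    have hN : Nf (0, Δ) = q₀ + c₁ * Δ + κ * Δ ^ 2 := by
      have hs : star (-(w₀ + ((Δ : ℝ) : ℂ) • w₁)) = -(star w₀ + ((Δ : ℝ) : ℂ) • star w₁) := by
        rw [star_neg, star_add, star_smul, Complex.star_def, Complex.conj_ofReal]
      have e1 : star (yf (0, Δ)) ⬝ᵥ yf (0, Δ) =
          star w₀ ⬝ᵥ w₀ + ((Δ : ℝ) : ℂ) * (star w₀ ⬝ᵥ w₁ + star w₁ ⬝ᵥ w₀) +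
            (((Δ ^ 2 : ℝ) : ℝ) : ℂ) * (star w₁ ⬝ᵥ w₁) := by
        rw [hy0 Δ, hs]
        simp only [neg_dotProduct, dotProduct_neg, add_dotProduct, dotProduct_add, smul_dotProduct,
          dotProduct_smul, smul_eq_mul]
        push_cast
        ring
      have e2 : star (yf (0, Δ)) ⬝ᵥ (A *ᵥ yf (0, Δ)) =
          star w₀ ⬝ᵥ (A *ᵥ w₀) + ((Δ : ℝ) : ℂ) * (star w₀ ⬝ᵥ (A *ᵥ w₁) + star w₁ ⬝ᵥ (A *ᵥ w₀)) +
            (((Δ ^ 2 : ℝ) : ℝ) : ℂ) * (star w₁ ⬝ᵥ (A *ᵥ w₁)) := by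
        rw [hy0 Δ, hs]
        simp only [mulVec_neg, mulVec_add, mulVec_smul, neg_dotProduct, dotProduct_neg,
          add_dotProduct, dotProduct_add, smul_dotProduct, dotProduct_smul, smul_eq_mul]
        push_cast
        ring
      simp only [hNf]
      rw [e1, e2]
      simp only [Complex.add_re, Complex.re_ofReal_mul, hq₀, hc₁, hκ]
      ring
    have hD : Df (0, Δ) = d₀ := by simp only [hDf, hv0 Δ, hd₀]
    simp only [hGf, hN, hD]
    have hd : d₀ ≠ 0 := hφpos.ne'
    field_simp
  have hG0'' : ∀ Δ : ℝ, iteratedDeriv 2 (fun Δ' => Gf (0, Δ')) Δ = 2 * (κ / d₀) := by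
    intro Δ
    have h : (fun Δ' => Gf (0, Δ')) = fun x => q₀ / d₀ + (c₁ / d₀) * x + (κ / d₀) * x ^ 2 :=
      funext hG0
    rw [h, iteratedDeriv_two_quadratic]
  -- (4) the tube
  set G₂ : ℝ × ℝ → ℝ := fun p => iteratedDeriv 2 (fun Δ' => Gf (p.1, Δ')) p.2 with hG₂
  have hG₂cont : Continuous G₂ := continuous_iteratedDeriv_two_curry Gf hG2
  have hSopen : IsOpen (G₂ ⁻¹' Set.Ioi 0) := isOpen_Ioi.preimage hG₂cont
  have hsub : ({(0 : ℝ)} : Set ℝ) ×ˢ Set.Icc (-1 : ℝ) 0 ⊆ G₂ ⁻¹' Set.Ioi 0 := by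
    rintro ⟨β, Δ⟩ ⟨hβ, -⟩
    rw [Set.mem_singleton_iff] at hβ
    subst hβ
    simp only [Set.mem_preimage, Set.mem_Ioi, hG₂, hG0'' Δ]
    exact mul_pos two_pos (div_pos hκpos hφpos)
  obtain ⟨u, v, hu, -, h0u, hIv, huv⟩ :=
    generalized_tube_lemma isCompact_singleton isCompact_Icc hSopen hsub
  have h0u' : (0 : ℝ) ∈ u := h0u (Set.mem_singleton 0)
  obtain ⟨ε, hε, hball⟩ := Metric.isOpen_iff.mp hu 0 h0u'
  refine ⟨ε / 2, half_pos hε, fun β hβ => ?_⟩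
  -- for such `β`, `G(β, ·)` is convex on `[-1, 0]`
  have hβu : β ∈ u := hball (by
    rw [Metric.mem_ball, Real.dist_eq, sub_zero, abs_of_pos hβ.1]
    linarith [hβ.2])
  have hconv : ConvexOn ℝ (Set.Icc (-1 : ℝ) 0) (fun Δ => Gf (β, Δ)) := by
    refine convexOn_Icc_of_iteratedDeriv_two_nonneg _ (hG2.comp (contDiff_const.prodMk contDiff_id)) ?_
    intro x hx
    have hmem : (β, x) ∈ u ×ˢ v := ⟨hβu, hIv (Set.Ioo_subset_Icc_self hx)⟩
    have h := huv hmem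
    simp only [Set.mem_preimage, Set.mem_Ioi, hG₂] at h
    exact h.le
  -- hence `Λˢ_β = a − β² G(β, ·)` is concave
  have hconc : ConcaveOn ℝ (Set.Icc (-1 : ℝ) 0) (fun Δ => a + -(β ^ 2 • Gf (β, Δ))) :=
    (concaveOn_const a (convex_Icc _ _)).add (hconv.smul (sq_nonneg β)).neg
  refine hconc.congr fun Δ _ => ?_
  simp only [smul_eq_mul]
  rw [hident β Δ]
  ring

open Summit.HubbardSuperconductivity.HubbardSuperconductivity.Theorems.AnisotropyChord.CondensateSlab in
/-- **Registered stub `stub_slabConcave_smallBeta`** (line `condensate-slab` of crux `ChordXY`, lead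
skeleton `Cruxes/ChordXY/Lines/doob_johnson_chord.lean`, section `CondensateSlab`), BY NAME — for every
even `M ≥ 4` there is `β₀ > 0` such that `Δ ↦ Λˢ_{β,M}(Δ)` is concave on `[-1,0]` for all
`β ∈ (0, β₀]` (`slabCondensate_concaveOn_smallBeta`).  The graph-blind rung of the line.
Kato II §2; Tasaki (2020) §2.4–2.5. [folklore] -/
theorem stub_slabConcave_smallBeta : ∀ (M : ℕ) [NeZero M], Even M → 4 ≤ M → ∃ β₀ : ℝ, 0 < β₀ ∧ ∀ β ∈ Set.Ioc (0:ℝ) β₀, ConcaveOn ℝ (Set.Icc (-1:ℝ) 0) (fun Δ : ℝ => slabCondensate M β Δ) :=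
  fun M _ hM h4 => slabCondensate_concaveOn_smallBeta M hM h4

end Summit.HubbardSuperconductivity.HubbardSuperconductivity.Theorems.AnisotropyChord

end
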